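import Summits.QuantumFields.BalabanUV.Beta.CapRouteA
import Summits.QuantumFields.BalabanUV.Beta.VertexToriSymmetryEnds

/-!
# Beta / ResolventBoxCertificate — the KERNEL INTERFACE of a BOX CERTIFICATE of the resolvent norm on the vertex tori: per-box data
# (centre, half-widths, preconditioner, centre residual, Lipschitz majorant) ⟹ route A's binder `hBa : ∀ p ∈ VertexTori κ, ‖(A p)⁻¹‖ ≤ B`
# (β sub-cell, BINDER-OWNERS row CAP-k, lineage `b2b-balaban-beta-an5`, gen 22; node BETA-an5-g22-TORI-SYMMETRY, annex)

Under decision (b) the only certificate of CERT row 11 the lane can build is the L-CF BOX CERTIFICATE of `‖k₀(q)⁻¹‖₂` on the vertex tori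
(CAP-KERNEL v0.7.12 §4.21 ∕ §4.23 (e): «defect certificate `‖1 − P_m(x)k₀(x)‖ ≤ θ ⇒ ‖k₀(x)⁻¹‖ ≤ ‖P_m‖∕(1−θ)`»).  This module states, in the
kernel and BY NAME, what such a certificate must deliver per leaf for the binder `hBa` of `CapRouteA.rowsOfOneLoopFormCode16E_routeA₂` to be
instantiated — so that «(Z2a) ⟹ one constructor application» holds at LEAF granularity.  NO LEAF COUNT OR BOX SIZE IS ASSERTED HERE (DOCFIX gen 23,
OBJECTION G-cap1g10-2, cap1-g10 journal l.14070 ∕ cap-ref #82 R82-c: the v1 text quoted «≈ 3e4–3e5 leaves; J23 box schedule» — a pricing that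
belongs to a different certificate; for the cell's `k₀` the ORDER-0 leaf of §3 below (constant preconditioner + first-order Lipschitz majorant)
needs `h ≤ 2·10⁻⁵`, hence is not the usable leaf; the USABLE leaf is the ORDER-m one — momentum-dependent polynomial preconditioner + order-m Taylor
tail — of the companion module `Beta.ResolventBoxCertificateTaylor` (`box_certificate_taylor`), whose per-leaf conclusion is the same and feeds
`of_cover` ∕ `hBa_of_boxes_negConjRegion` below unchanged):

* §1 KRAWCZYK IN THE EUCLIDEAN OPERATOR NORM (θ-general, no series): `‖1 − T‖ ≤ θ < 1 ⟹ IsUnit T ∧ ‖T⁻¹‖ ≤ 1/(1−θ)` (kernel-vector argument of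
  `GAN24.BorderedFrameInverse` + the identity `T⁻¹ = 1 + (1 − T)T⁻¹`), and the PRECONDITIONED form `‖1 − P·M‖ ≤ θ < 1 ⟹ IsUnit M.det ∧
  ‖M⁻¹‖ ≤ ‖P‖∕(1−θ)` (`krawczyk`).
* §2 THE LIPSCHITZ MAJORANT OF A STENCIL FAMILY ON A BOX, in closed form from the tables: for two momenta with EQUAL imaginary parts,
  `‖χ_q(x) − χ_c(x)‖ ≤ e^{−Σ_μ x_μ Im c_μ}·|Σ_μ x_μ (Re q_μ − Re c_μ)|` (`norm_character_sub_le`; Mathlib's `‖e^{it} − 1‖ ≤ |t|`), hence on the box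
  `|Re q_μ − Re c_μ| ≤ h_μ`: `‖Σ_x χ_q(x)K[x] − Σ_x χ_c(x)K[x]‖ ≤ Σ_{x∈S} e^{−Σ_μ x_μ Im c_μ}·(Σ_μ |x_μ| h_μ)·‖K[x]‖` (`norm_characterSum_sub_le_of_box`)
  — a NUMBER computable from the typed tables, no engine.
* §3 THE BOX CERTIFICATE (ORDER 0; the order-m leaf is `ResolventBoxCertificateTaylor.box_certificate_taylor`): `Box c h = {q : |Re q_μ − Re c_μ|
  ≤ h_μ, Im q_μ = Im c_μ ∀μ}` (complex centre `c` on a sign-class torus); per box a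
  preconditioner `P` (any matrix — in practice the float inverse at the centre), a centre residual `‖1 − P·A(c)‖ ≤ θ₀`, a Lipschitz majorant
  `‖A q − A c‖ ≤ L` on the box, and the two checks `θ₀ + ‖P‖·L ≤ θ < 1`, `‖P‖∕(1−θ) ≤ B` ⟹ `‖(A q)⁻¹‖ ≤ B` AND `IsUnit (A q).det` on the box
  (`box_certificate` — the same leaf certifies (Z1)'s face data); a finite family of boxes COVERING a region transfers the bound to the region
  (`of_cover`); composed with `VertexToriSymmetryEnds.invNorm_le_vertexTori_of_negConjRegion` the region may be the quarter
  `{Im q_{ν₀} = +κ, Re q_{ν₁} ≤ 0}` of the vertex tori (`hBa_of_boxes_negConjRegion`).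

HONEST FRAMING.  Kernel glue ([folklore] linear algebra): no box, no preconditioner, no number is supplied here; the per-box inequalities are
exactly what two independent implementations must certify (R78-c (iii), R79-b-1); 0 binders instantiated.  Discharging `BetaPertH` would make
Bałaban's ultraviolet stability unconditional — NOT the continuum limit, NOT the Clay problem.  0 `sorry`, 0 cite tags.
-/

namespace Summit.QuantumFields.BalabanUV.Beta.ResolventBoxCertificate

open Complex Set Matrix
open Literature.MathematicalPhysics.QuantumFieldTheory.Balaban1983to89
open Summit.QuantumFields.BalabanUV.Beta.TubeMaximumModulus
open Summit.QuantumFields.BalabanUV.Beta.PolyRegularAlgebra (character)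
open Summit.QuantumFields.BalabanUV.Beta.VertexToriSymmetry
open Summit.QuantumFields.BalabanUV.Beta.ConjReflectionAlgebra (MatConjSymm)
open Summit.QuantumFields.BalabanUV.Beta.GAN24.BorderedFrameInverse (isUnit_of_mulVec_eq_zero)
open scoped Real ComplexConjugate Matrix.Norms.L2Operator

noncomputable section

variable {d : ℕ} {n : Type*} [Fintype n] [DecidableEq n]

/-! ## §1 Krawczyk in the Euclidean operator norm -/

section Krawczyk

/-- a matrix within operator-norm distance `< 1` of the identity is invertible (a kernel vector `x = (1 − T)x` has `‖x‖ ≤ θ‖x‖`). [folklore] -/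
theorem isUnit_of_norm_one_sub_lt {T : Matrix n n ℂ} (hT : ‖1 - T‖ < 1) : IsUnit T := by
  refine isUnit_of_mulVec_eq_zero fun x hx => ?_
  have hx' : (1 - T) *ᵥ x = x := by rw [sub_mulVec, one_mulVec, hx, sub_zero]
  set y : EuclideanSpace ℂ n := WithLp.toLp 2 x with hy
  have hle : ‖y‖ ≤ ‖1 - T‖ * ‖y‖ := by
    have h := Matrix.l2_opNorm_mulVec (1 - T) y
    have e : (EuclideanSpace.equiv n ℂ).symm ((1 - T) *ᵥ y.ofLp) = y := by
      rw [hy]; simp [hx']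
    rwa [e] at h
  have h0 : ‖y‖ = 0 := by
    by_contra hne
    have hpos : 0 < ‖y‖ := lt_of_le_of_ne (norm_nonneg _) (Ne.symm hne)
    have : 1 ≤ ‖1 - T‖ := by
      by_contra hlt
      have := mul_lt_mul_of_pos_right (not_le.mp hlt) hpos
      rw [one_mul] at this
      exact absurd hle (not_le.mpr this)
    exact absurd hT (not_lt.mpr this)
  have : y = 0 := norm_eq_zero.mp h0
  rw [hy] at this
  exact (WithLp.toLp_injective 2) (by simpa using this)

/-- **`‖1 − T‖ ≤ θ < 1 ⟹ T invertible and ‖T⁻¹‖ ≤ 1/(1−θ)`** (from `T⁻¹ = 1 + (1 − T)·T⁻¹`). [folklore] -/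
theorem norm_inv_le_of_norm_one_sub_le {T : Matrix n n ℂ} {θ : ℝ} (hT : ‖1 - T‖ ≤ θ) (hθ : θ < 1) :
    IsUnit T.det ∧ ‖T⁻¹‖ ≤ 1 / (1 - θ) := by
  have hU : IsUnit T := isUnit_of_norm_one_sub_lt (lt_of_le_of_lt hT hθ)
  have hdet : IsUnit T.det := (Matrix.isUnit_iff_isUnit_det _).1 hU
  refine ⟨hdet, ?_⟩
  have e : T⁻¹ = 1 + (1 - T) * T⁻¹ := by
    rw [Matrix.sub_mul, Matrix.one_mul, Matrix.mul_nonsing_inv _ hdet]; abel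
  -- `‖1‖₂ ≤ 1` (the tree's `SolovayKitaev.norm_one_le_one`, re-derived inline to keep the imports inside the β sub-cell)
  have h1 : ‖(1 : Matrix n n ℂ)‖ ≤ 1 := by
    rw [← diagonal_one, l2_opNorm_diagonal]
    exact (pi_norm_le_iff_of_nonneg zero_le_one).mpr fun _ => by simp
  have hb : ‖T⁻¹‖ ≤ 1 + θ * ‖T⁻¹‖ := by
    calc ‖T⁻¹‖ = ‖1 + (1 - T) * T⁻¹‖ := by rw [← e]
      _ ≤ ‖(1 : Matrix n n ℂ)‖ + ‖(1 - T) * T⁻¹‖ := norm_add_le _ _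
      _ ≤ 1 + ‖1 - T‖ * ‖T⁻¹‖ := add_le_add h1 (l2_opNorm_mul _ _)
      _ ≤ 1 + θ * ‖T⁻¹‖ := by gcongr
  have h1θ : 0 < 1 - θ := by linarith
  rw [le_div_iff₀ h1θ]
  nlinarith [norm_nonneg T⁻¹]

/-- **KRAWCZYK, PRECONDITIONED**: `‖1 − P·M‖ ≤ θ < 1 ⟹ M invertible and ‖M⁻¹‖ ≤ ‖P‖∕(1−θ)` (`M⁻¹ = (P·M)⁻¹·P`). [folklore] -/
theorem krawczyk {P M : Matrix n n ℂ} {θ : ℝ} (h : ‖1 - P * M‖ ≤ θ) (hθ : θ < 1) :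
    IsUnit M.det ∧ ‖M⁻¹‖ ≤ ‖P‖ / (1 - θ) := by
  obtain ⟨hT, hTinv⟩ := norm_inv_le_of_norm_one_sub_le h hθ
  have hM : IsUnit M.det := by
    rw [det_mul] at hT; exact isUnit_of_mul_isUnit_right hT
  refine ⟨hM, ?_⟩
  have e : M⁻¹ = (P * M)⁻¹ * P := by
    have h1 : (P * M)⁻¹ * P * M = 1 := by rw [Matrix.mul_assoc, Matrix.nonsing_inv_mul _ hT]
    exact (Matrix.inv_eq_left_inv h1)
  have h1θ : 0 < 1 - θ := by linarith
  calc ‖M⁻¹‖ = ‖(P * M)⁻¹ * P‖ := by rw [e]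
    _ ≤ ‖(P * M)⁻¹‖ * ‖P‖ := l2_opNorm_mul _ _
    _ ≤ 1 / (1 - θ) * ‖P‖ := by gcongr
    _ = ‖P‖ / (1 - θ) := by ring

end Krawczyk

/-! ## §2 The Lipschitz majorant of a stencil family on a box -/

section Lipschitz

/-- the exponent of a character splits into real and imaginary parts. [folklore] -/
private theorem charExponent_eq (x : Fin (d + 1) → ℤ) (q : Fin (d + 1) → ℂ) :
    I * ∑ μ, (x μ : ℂ) * q μ = ((-(∑ μ, (x μ : ℝ) * (q μ).im) : ℝ) : ℂ) + I * ((∑ μ, (x μ : ℝ) * (q μ).re : ℝ) : ℂ) := by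
  apply Complex.ext
  · simp [Complex.mul_re, Complex.mul_im, Complex.re_sum, Complex.im_sum]
  · simp [Complex.mul_re, Complex.mul_im, Complex.re_sum, Complex.im_sum]

/-- a character in polar form: `χ_q(x) = e^{−Σ x_μ Im q_μ} · e^{i Σ x_μ Re q_μ}`. [folklore] -/
theorem character_eq_polar (x : Fin (d + 1) → ℤ) (q : Fin (d + 1) → ℂ) :
    character x q = (Real.exp (-(∑ μ, (x μ : ℝ) * (q μ).im)) : ℂ) * cexp (I * ((∑ μ, (x μ : ℝ) * (q μ).re : ℝ) : ℂ)) := by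
  unfold character
  rw [charExponent_eq, Complex.exp_add, Complex.ofReal_exp]

/-- **two momenta with EQUAL imaginary parts**: `‖χ_q(x) − χ_c(x)‖ ≤ e^{−Σ_μ x_μ Im c_μ} · |Σ_μ x_μ (Re q_μ − Re c_μ)|`. [folklore] -/
theorem norm_character_sub_le (x : Fin (d + 1) → ℤ) {q c : Fin (d + 1) → ℂ} (him : ∀ μ, (q μ).im = (c μ).im) :
    ‖character x q - character x c‖
      ≤ Real.exp (-(∑ μ, (x μ : ℝ) * (c μ).im)) * |∑ μ, (x μ : ℝ) * ((q μ).re - (c μ).re)| := by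
  rw [character_eq_polar, character_eq_polar]
  simp only [him]
  set a : ℝ := ∑ μ, (x μ : ℝ) * (q μ).re with ha
  set b : ℝ := ∑ μ, (x μ : ℝ) * (c μ).re with hb
  set w : ℝ := Real.exp (-(∑ μ, (x μ : ℝ) * (c μ).im)) with hw
  have hab : a - b = ∑ μ, (x μ : ℝ) * ((q μ).re - (c μ).re) := by
    rw [ha, hb, ← Finset.sum_sub_distrib]
    exact Finset.sum_congr rfl fun μ _ => by ring
  rw [← mul_sub, norm_mul, Complex.norm_real, Real.norm_of_nonneg (Real.exp_pos _).le, ← hab]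
  refine mul_le_mul_of_nonneg_left ?_ (Real.exp_pos _).le
  -- `e^{ia} − e^{ib} = e^{ib}(e^{i(a−b)} − 1)`
  have e : cexp (I * (a : ℂ)) - cexp (I * (b : ℂ)) = cexp (I * (b : ℂ)) * (cexp (I * ((a - b : ℝ) : ℂ)) - 1) := by
    rw [mul_sub, mul_one, ← Complex.exp_add]; push_cast; ring_nf
  rw [e, norm_mul, Complex.norm_exp_I_mul_ofReal, one_mul]
  have h := Real.norm_exp_I_mul_ofReal_sub_one_le (x := a - b)
  rwa [Real.norm_eq_abs] at h

/-- on a BOX `|Re q_μ − Re c_μ| ≤ h_μ`: `|Σ_μ x_μ (Re q_μ − Re c_μ)| ≤ Σ_μ |x_μ| h_μ`. [folklore] -/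
theorem abs_sum_mul_sub_le (x : Fin (d + 1) → ℤ) {q c : Fin (d + 1) → ℂ} {h : Fin (d + 1) → ℝ}
    (hre : ∀ μ, |(q μ).re - (c μ).re| ≤ h μ) :
    |∑ μ, (x μ : ℝ) * ((q μ).re - (c μ).re)| ≤ ∑ μ, |(x μ : ℝ)| * h μ := by
  refine (Finset.abs_sum_le_sum_abs _ _).trans (Finset.sum_le_sum fun μ _ => ?_)
  rw [abs_mul]
  exact mul_le_mul_of_nonneg_left (hre μ) (abs_nonneg _)

/-- **THE LIPSCHITZ MAJORANT OF A STENCIL FAMILY ON A BOX** (closed form from the tables): with equal imaginary parts and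
`|Re q_μ − Re c_μ| ≤ h_μ`, `‖A q − A c‖ ≤ Σ_{x ∈ S} e^{−Σ_μ x_μ Im c_μ} · (Σ_μ |x_μ| h_μ) · ‖K[x]‖` for `A q = Σ_{x ∈ S} χ_q(x) K[x]`. [folklore] -/
theorem norm_characterSum_sub_le_of_box (S : Finset (Fin (d + 1) → ℤ)) (K : (Fin (d + 1) → ℤ) → Matrix n n ℂ)
    {q c : Fin (d + 1) → ℂ} (him : ∀ μ, (q μ).im = (c μ).im) {h : Fin (d + 1) → ℝ} (hre : ∀ μ, |(q μ).re - (c μ).re| ≤ h μ) :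
    ‖(∑ x ∈ S, character x q • K x) - ∑ x ∈ S, character x c • K x‖
      ≤ ∑ x ∈ S, Real.exp (-(∑ μ, (x μ : ℝ) * (c μ).im)) * (∑ μ, |(x μ : ℝ)| * h μ) * ‖K x‖ := by
  rw [← Finset.sum_sub_distrib]
  refine (norm_sum_le _ _).trans (Finset.sum_le_sum fun x _ => ?_)
  rw [← sub_smul, norm_smul]
  refine mul_le_mul_of_nonneg_right ?_ (norm_nonneg _)
  exact (norm_character_sub_le x him).trans
    (mul_le_mul_of_nonneg_left (abs_sum_mul_sub_le x hre) (Real.exp_pos _).le)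

end Lipschitz

/-! ## §3 The box certificate, covers, and the END into route A's `hBa` -/

section Boxes

/-- the BOX with complex centre `c` (on a sign-class torus) and real half-widths `h`: same imaginary parts, real parts within `h`. [folklore] -/
def Box (c : Fin (d + 1) → ℂ) (h : Fin (d + 1) → ℝ) : Set (Fin (d + 1) → ℂ) :=
  {q | ∀ μ, |(q μ).re - (c μ).re| ≤ h μ ∧ (q μ).im = (c μ).im}

variable {A : (Fin (d + 1) → ℂ) → Matrix n n ℂ}

/-- **THE BOX CERTIFICATE** (one leaf): a preconditioner `P`, a centre residual `‖1 − P·A(c)‖ ≤ θ₀`, a Lipschitz majorant `‖A q − A c‖ ≤ L` on the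
box, and the checks `θ₀ + ‖P‖·L ≤ θ < 1`, `‖P‖∕(1−θ) ≤ B` ⟹ on the whole box `A q` is invertible and `‖(A q)⁻¹‖ ≤ B`. [folklore] -/
theorem box_certificate {c : Fin (d + 1) → ℂ} {h : Fin (d + 1) → ℝ} (P : Matrix n n ℂ) {θ₀ L θ B : ℝ}
    (hcentre : ‖1 - P * A c‖ ≤ θ₀) (hLip : ∀ q ∈ Box c h, ‖A q - A c‖ ≤ L) (hθ : θ₀ + ‖P‖ * L ≤ θ) (hθ1 : θ < 1)
    (hB : ‖P‖ / (1 - θ) ≤ B) : ∀ q ∈ Box c h, IsUnit (A q).det ∧ ‖(A q)⁻¹‖ ≤ B := by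
  intro q hq
  have hres : ‖1 - P * A q‖ ≤ θ := by
    have e : 1 - P * A q = (1 - P * A c) + P * (A c - A q) := by rw [Matrix.mul_sub]; abel
    calc ‖1 - P * A q‖ = ‖(1 - P * A c) + P * (A c - A q)‖ := by rw [e]
      _ ≤ ‖1 - P * A c‖ + ‖P * (A c - A q)‖ := norm_add_le _ _
      _ ≤ θ₀ + ‖P‖ * ‖A c - A q‖ := add_le_add hcentre (l2_opNorm_mul _ _)
      _ ≤ θ₀ + ‖P‖ * L := by gcongr; rw [norm_sub_rev]; exact hLip q hq
      _ ≤ θ := hθ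
  obtain ⟨hU, hN⟩ := krawczyk hres hθ1
  exact ⟨hU, hN.trans hB⟩

/-- the Lipschitz hypothesis of `box_certificate` for a STENCIL FAMILY, from the closed-form majorant of §2. [folklore] -/
theorem lipschitz_of_characterSum (S : Finset (Fin (d + 1) → ℤ)) (K : (Fin (d + 1) → ℤ) → Matrix n n ℂ)
    (c : Fin (d + 1) → ℂ) (h : Fin (d + 1) → ℝ) {L : ℝ}
    (hL : ∑ x ∈ S, Real.exp (-(∑ μ, (x μ : ℝ) * (c μ).im)) * (∑ μ, |(x μ : ℝ)| * h μ) * ‖K x‖ ≤ L) :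
    ∀ q ∈ Box c h, ‖(∑ x ∈ S, character x q • K x) - ∑ x ∈ S, character x c • K x‖ ≤ L :=
  fun _ hq => (norm_characterSum_sub_le_of_box S K (fun μ => (hq μ).2) (fun μ => (hq μ).1)).trans hL

/-- **COVER**: a finite family of certified boxes covering a region `R` certifies `R`. [folklore] -/
theorem of_cover {ι : Type*} (boxes : Finset ι) (ctr : ι → Fin (d + 1) → ℂ) (hw : ι → Fin (d + 1) → ℝ)
    {R : Set (Fin (d + 1) → ℂ)} (hcov : ∀ q ∈ R, ∃ b ∈ boxes, q ∈ Box (ctr b) (hw b)) {B : ℝ}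
    (hcert : ∀ b ∈ boxes, ∀ q ∈ Box (ctr b) (hw b), IsUnit (A q).det ∧ ‖(A q)⁻¹‖ ≤ B) :
    ∀ q ∈ R, IsUnit (A q).det ∧ ‖(A q)⁻¹‖ ≤ B := by
  intro q hq
  obtain ⟨b, hb, hqb⟩ := hcov q hq
  exact hcert b hb q hqb

variable {w : Fin (d + 1) → ℝ}

/-- **END INTO ROUTE A's `hBa`** (all vertex tori): boxes covering the QUARTER-REGION `{Im q_{ν₀} = +w_{ν₀}, Re q_{ν₁} ≤ 0}` of the vertex tori +
per-box certificates + the two isometric symmetries of the resolvent norm (`MatNegTranspose A`, `MatConjSymm A` —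
`VertexToriSymmetryEnds.invNorm_le_vertexTori_of_negConjRegion`) ⟹ `∀ p ∈ VertexTori w, ‖(A p)⁻¹‖ ≤ B`. [folklore] -/
theorem hBa_of_boxes_negConjRegion (hA : MatNegTranspose A) (hA' : MatConjSymm A) (ν₀ ν₁ : Fin (d + 1))
    {ι : Type*} (boxes : Finset ι) (ctr : ι → Fin (d + 1) → ℂ) (hw : ι → Fin (d + 1) → ℝ)
    (hcov : ∀ q ∈ VertexTori w, (q ν₀).im = w ν₀ → (q ν₁).re ≤ 0 → ∃ b ∈ boxes, q ∈ Box (ctr b) (hw b)) {B : ℝ}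
    (hcert : ∀ b ∈ boxes, ∀ q ∈ Box (ctr b) (hw b), IsUnit (A q).det ∧ ‖(A q)⁻¹‖ ≤ B) :
    ∀ p ∈ VertexTori w, ‖(A p)⁻¹‖ ≤ B :=
  invNorm_le_vertexTori_of_negConjRegion hA hA' ν₀ ν₁ fun q hq h0 h1 => by
    obtain ⟨b, hb, hqb⟩ := hcov q hq h0 h1
    exact (hcert b hb q hqb).2

/-- the same boxes also deliver (Z1)'s FACE DATA on the covered region: `det (A q) ≠ 0` there. [folklore] -/
theorem det_ne_zero_of_boxes {ι : Type*} (boxes : Finset ι) (ctr : ι → Fin (d + 1) → ℂ) (hw : ι → Fin (d + 1) → ℝ)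
    {R : Set (Fin (d + 1) → ℂ)} (hcov : ∀ q ∈ R, ∃ b ∈ boxes, q ∈ Box (ctr b) (hw b)) {B : ℝ}
    (hcert : ∀ b ∈ boxes, ∀ q ∈ Box (ctr b) (hw b), IsUnit (A q).det ∧ ‖(A q)⁻¹‖ ≤ B) :
    ∀ q ∈ R, (A q).det ≠ 0 :=
  fun q hq => ((of_cover boxes ctr hw hcov hcert) q hq).1.ne_zero

end Boxes

end

end Summit.QuantumFields.BalabanUV.Beta.ResolventBoxCertificate
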